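import Summits.BirchSwinnertonDyer.Rank1Residual.ManinAdditive.ShimuraCoverMuThree
import Literature.NumberTheory.EllipticCurves.ManinConstantGamma1Gamma0LedgerProofs
import Literature.NumberTheory.EllipticCurves.BSDWave0
import Mathlib.GroupTheory.SpecificGroups.Cyclic
import HarnessLib

/-!
# E-es-189: the ODD part of the Shimura kernel is cyclic — `Λ₁(f) ⊄ ℓΛ₀(f)` for every odd prime `ℓ`, modulo F★ and Mazur's torsion theorem
(route `ManinLocalTwoThree`, crux C2 `ManinOddAtFour` stmt-BirchSwinnertonDyer-22967; cell bsd-f2-manin, prover seat p2 gen 23;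
`--supports stmt-BirchSwinnertonDyer-22967`; es g40 row E-es-189 `OptimalGamma1PeriodsNotInsideOddPrime` (MEMO-es §61.4), the odd half of
desc g26 row 2 `ShimuraCyclic.ShimuraKernelCyclic`; companion of `…ShimuraKernelCyclicLattice` (E-es-190) and of p3's
`KummerValues.not_halfIndex_of_modularity_of_kummerValues` (the `2`-part, E-es-188♭))

For an OPTIMAL `X₁(N)`-datum `D₁` of `W₁` (`Λ_{W₁} = c₁Λ₁(f)`, Stevens' curve) the points `π₁(c₁x)`, `x ∈ Λ₀(f)`, are RATIONAL
(F★ `optimalGamma1Parametrization_cusp_rational`, via an's `ShimuraCover.exists_rational_eq_uniformize_of_mem_periodLattice`): the Shimura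
kernel `π₁(c₁Λ₀(f)) ≅ Λ₀(f)/Λ₁(f)` is a constant subgroup of `W₁(ℚ)_tors` (Vatsal 2005, Rem. 1.8).  If `Λ₁(f) ⊆ ℓΛ₀(f)` for a prime `ℓ`,
then `W₁[ℓ] = π₁(c₁Λ₁(f)/ℓ) ⊆ π₁(c₁Λ₀(f))`, so `W₁(ℚ)_tors` contains `ℓ²` points killed by `ℓ`; for ODD `ℓ` none of Mazur's fifteen groups
`ℤ/n` (`n ≤ 10`, `n = 12`), `ℤ/2 × ℤ/2m` (`m ≤ 4`) does (their `ℓ`-torsion is cyclic of order `≤ ℓ`).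

* §1 `false_of_injective_of_mazurShape` — the group-theoretic core: no injection `Fin ℓ × Fin ℓ ↪ G` into `ℓ`-torsion points of an
  abelian group whose torsion subgroup has one of Mazur's two shapes, `ℓ` an odd prime (`IsAddCyclic.card_nsmul_eq_zero_le` on `ZMod n`,
  resp. on the `ZMod (2m)` factor after the `ZMod 2` coordinate is forced to vanish);
* §2 **`not_prime_le_of_isOptimal`** — E-es-189 on Stevens' curve: `F★ → (∀ V, mazur_torsion V) → D₁.IsOptimal → ℓ odd prime →
  ¬ (Λ₁(f) ⊆ ℓΛ₀(f))`;
* §3 **`not_prime_le_of_latticeOptimal`** — the lattice-optimal `X₀(N)`-datum form (es's E-es-189 binders) ⟸ + CES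
  (`exists_optimal_gamma1ParametrizationData`, same newform by `Gamma1ParametrizationData.f_eq_of_isIsogenous`).

HONEST FRAMING: CONDITIONAL on the statement-only printed facts F★ (Stevens 1982 Thm. 1.3.1 (a) / Conrad–Edixhoven–Stein 2003 §6),
Mazur's torsion theorem (`mazur_torsion`, BSDWave0 S05) and, for §3, CES.  Print has the odd part as «the Shimura cover is étale over
`ℤ[1/2]`, hence its kernel's odd part is cyclic» (Vatsal 2005, p. 15); the route here is Mazur's list instead of the Weil pairing.
Nothing about the `2`-part, C2, Manin's conjecture or BSD is proved.  No definitions, no sorry.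
[cite: Vatsal2005, Rem. 1.4, Rem. 1.8] [cite: Mazur1977, Thm 8] [cite: Stevens1982, §1.3 Thm. 1.3.1 (a)] [cite: ConradEdixhovenStein2003, §6.1.2, §6.2]
-/

set_option autoImplicit false
-- lint-debt: the directory name repeats the summit name (sibling precedent `ManinLocalTwoThreeKummerValuesHalfIndex.lean`)
set_option linter.dupNamespace false

noncomputable section

open scoped Classical MatrixGroups
open CongruenceSubgroup WeierstrassCurve Literature.NumberTheory.EllipticCurves Literature.NumberTheory.EllipticCurves.ModularForms
open Summit.BirchSwinnertonDyer.Rank1Residual.ManinAdditive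

namespace Summit.BirchSwinnertonDyer.BirchSwinnertonDyer.Theorems.ManinLocalTwoThree.ShimuraKernelOddPart

/-! ## §1 The group-theoretic core: Mazur's fifteen groups have cyclic odd parts -/

/-- In `ZMod n` (`n ≥ 1`) at most `ℓ` elements are killed by `ℓ ≥ 1`; hence no injection from a type with more than `ℓ` elements into them.
[cite: Mazur1977, Thm 8] -/
theorem false_of_injective_zmod {ι : Type*} [Fintype ι] {n ℓ : ℕ} (hn : 1 ≤ n) (hℓ : 0 < ℓ) (hcard : ℓ < Fintype.card ι)
    (g : ι → ZMod n) (hg : Function.Injective g) (hℓg : ∀ x, ℓ • g x = 0) : False := by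
  haveI : NeZero n := ⟨by omega⟩
  have hle := IsAddCyclic.card_nsmul_eq_zero_le (α := ZMod n) hℓ
  have hsub : Finset.univ.image g ⊆ Finset.univ.filter (fun a : ZMod n ↦ ℓ • a = 0) := by
    intro a ha
    obtain ⟨x, -, rfl⟩ := Finset.mem_image.mp ha
    simpa using hℓg x
  have h1 : Fintype.card ι ≤ ℓ := by
    calc Fintype.card ι = (Finset.univ.image g).card := (Finset.card_image_of_injective _ hg).symm
      _ ≤ (Finset.univ.filter (fun a : ZMod n ↦ ℓ • a = 0)).card := Finset.card_le_card hsub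
      _ ≤ ℓ := hle
  omega

/-- In `ZMod 2`, an ODD multiple of `a` is `a`. [folklore] -/
theorem odd_nsmul_zmod_two {ℓ : ℕ} (hℓ : Odd ℓ) (a : ZMod 2) : ℓ • a = a := by
  rw [nsmul_eq_mul, ZMod.natCast_eq_one_iff_odd.mpr hℓ, one_mul]

/-- **No `(ℤ/ℓ)²` inside Mazur's groups for odd `ℓ`.**  Let `G` be an abelian group whose torsion subgroup is isomorphic to `ℤ/n` or to
`ℤ/2 × ℤ/2m` (the two shapes of `mazur_torsion`), `ℓ` an odd prime, and `g : ι → G` an injective family of more than `ℓ` points killed by `ℓ`.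
Contradiction. [cite: Mazur1977, Thm 8] -/
theorem false_of_injective_of_mazurShape {G : Type*} [AddCommGroup G]
    (hM : (∃ n : ℕ, 1 ≤ n ∧ (n ≤ 10 ∨ n = 12) ∧ Nonempty (AddCommGroup.torsion G ≃+ ZMod n)) ∨
      (∃ m : ℕ, 1 ≤ m ∧ m ≤ 4 ∧ Nonempty (AddCommGroup.torsion G ≃+ ZMod 2 × ZMod (2 * m))))
    {ι : Type*} [Fintype ι] {ℓ : ℕ} (hℓ : ℓ.Prime) (hℓ2 : ℓ ≠ 2) (hcard : ℓ < Fintype.card ι)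
    (g : ι → G) (hg : Function.Injective g) (hℓg : ∀ x, ℓ • g x = 0) : False := by
  have hℓpos : 0 < ℓ := hℓ.pos
  have hℓodd : Odd ℓ := hℓ.odd_of_ne_two hℓ2
  -- the points are torsion
  have htor : ∀ x, g x ∈ AddCommGroup.torsion G := fun x ↦
    (AddCommGroup.mem_torsion (g x)).mpr (isOfFinAddOrder_iff_nsmul_eq_zero.mpr ⟨ℓ, hℓpos, hℓg x⟩)
  let g' : ι → AddCommGroup.torsion G := fun x ↦ ⟨g x, htor x⟩
  have hg' : Function.Injective g' := fun x y hxy ↦ hg (congrArg Subtype.val hxy)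
  have hℓg' : ∀ x, ℓ • g' x = 0 := fun x ↦ Subtype.ext (by simpa [g'] using hℓg x)
  rcases hM with ⟨n, hn, -, ⟨e⟩⟩ | ⟨m, hm, -, ⟨e⟩⟩
  · exact false_of_injective_zmod hn hℓpos hcard (e ∘ g') (e.injective.comp hg')
      fun x ↦ by simp only [Function.comp_apply, ← map_nsmul, hℓg', map_zero]
  · -- the `ZMod 2` coordinate vanishes, so the `ZMod (2m)` coordinate is injective
    have hfst : ∀ x, (e (g' x)).1 = 0 := fun x ↦ by
      have h := congrArg Prod.fst (show e (ℓ • g' x) = 0 by rw [hℓg', map_zero])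
      rw [map_nsmul, Prod.smul_fst, odd_nsmul_zmod_two hℓodd] at h
      simpa using h
    refine false_of_injective_zmod (n := 2 * m) (by omega) hℓpos hcard (fun x ↦ (e (g' x)).2) ?_ ?_
    · intro x y hxy
      apply hg'
      apply e.injective
      exact Prod.ext (by rw [hfst, hfst]) hxy
    · intro x
      have h := congrArg Prod.snd (show e (ℓ • g' x) = 0 by rw [hℓg', map_zero])
      rw [map_nsmul, Prod.smul_snd] at h
      simpa using h

/-! ## §2 E-es-189 on Stevens' curve: `Λ₁(f) ⊄ ℓΛ₀(f)` for odd primes `ℓ` -/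

variable {N : ℕ} [NeZero N]

/-- Lattice coordinates with denominator `ℓ`: `((a/ℓ)ω₁ + (b/ℓ)ω₂ ∈ Λ ↔ ℓ ∣ a ∧ ℓ ∣ b)`. [folklore] -/
theorem div_mul_ω₁_add_div_mul_ω₂_mem_lattice_iff (L : PeriodPair) {ℓ : ℕ} (hℓ : ℓ ≠ 0) (a b : ℤ) :
    ((a : ℂ) / ℓ) * L.ω₁ + ((b : ℂ) / ℓ) * L.ω₂ ∈ L.lattice ↔ (ℓ : ℤ) ∣ a ∧ (ℓ : ℤ) ∣ b := by
  have h := PeriodPair.mul_ω₁_add_mul_ω₂_mem_lattice (L := L) (α := (a : ℚ) / ℓ) (β := (b : ℚ) / ℓ)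
  have e : (((a : ℚ) / ℓ : ℚ) : ℂ) * L.ω₁ + (((b : ℚ) / ℓ : ℚ) : ℂ) * L.ω₂ = ((a : ℂ) / ℓ) * L.ω₁ + ((b : ℂ) / ℓ) * L.ω₂ := by
    push_cast; ring
  rw [e] at h
  rw [h]
  have hℓZ : (ℓ : ℤ) ≠ 0 := by exact_mod_cast hℓ
  have hden : ∀ m : ℤ, ((m : ℚ) / ℓ).den = 1 ↔ (ℓ : ℤ) ∣ m := fun m ↦ by
    have := Rat.den_div_intCast_eq_one_iff m ℓ hℓZ
    push_cast at this
    exact this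
  rw [hden a, hden b]

/-- **E-es-189 on Stevens' curve (CONDITIONAL on F★ and Mazur's torsion theorem).**  For an OPTIMAL `X₁(N)`-datum `D₁` of an elliptic `W₁/ℚ`
and an odd prime `ℓ`: `Λ₁(f) ⊄ ℓΛ₀(f)` (`f = D₁.f`).  Otherwise the `ℓ²` points `π₁((iω₁ + jω₂)/ℓ)`, `0 ≤ i, j < ℓ`, of `W₁[ℓ]` are
`π₁(c₁x)` with `x ∈ Λ₀(f)` (`ω_k = c₁λ_k`, `λ_k = ℓμ_k`), hence base changes of rational points (F★ via
`ShimuraCover.exists_rational_eq_uniformize_of_mem_periodLattice`), pairwise distinct and killed by `ℓ` — impossible in Mazur's groups (§1).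
[cite: Vatsal2005, Rem. 1.8] [cite: Mazur1977, Thm 8] [cite: Stevens1982, §1.3 Thm. 1.3.1 (a)] -/
theorem not_prime_le_of_isOptimal (hF : optimalGamma1Parametrization_cusp_rational) (hMT : ∀ V : WeierstrassCurve ℚ, mazur_torsion V)
    {W₁ : WeierstrassCurve ℚ} [W₁.IsElliptic] (D₁ : Gamma1ParametrizationData W₁ N) (hD₁ : D₁.IsOptimal)
    {ℓ : ℕ} (hℓ : ℓ.Prime) (hℓ2 : ℓ ≠ 2) :
    ¬ (∀ z ∈ periodLatticeGamma1 D₁.f, ∃ w ∈ periodLattice D₁.f, z = (ℓ : ℂ) * w) := by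
  intro hin
  have hℓ0 : ℓ ≠ 0 := hℓ.ne_zero
  have hℓC : (ℓ : ℂ) ≠ 0 := by exact_mod_cast hℓ0
  have hu0 : ∀ z, D₁.uniformize z = 0 ↔ z ∈ D₁.L.lattice := fun z ↦ by
    rw [← AddMonoidHom.mem_ker, ← SetLike.mem_coe, D₁.ker_uniformize, SetLike.mem_coe]
  -- `ω_k = c₁ λ_k = c₁ ℓ μ_k` with `μ_k ∈ Λ₀(f)`
  obtain ⟨l₁, hl₁, e₁⟩ := hD₁ _ D₁.L.ω₁_mem_lattice
  obtain ⟨l₂, hl₂, e₂⟩ := hD₁ _ D₁.L.ω₂_mem_lattice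
  obtain ⟨μ₁, hμ₁, f₁⟩ := hin _ hl₁
  obtain ⟨μ₂, hμ₂, f₂⟩ := hin _ hl₂
  have hω₁ : (D₁.c : ℂ) * μ₁ = D₁.L.ω₁ / ℓ := by rw [e₁, f₁]; field_simp
  have hω₂ : (D₁.c : ℂ) * μ₂ = D₁.L.ω₂ / ℓ := by rw [e₂, f₂]; field_simp
  -- the `ℓ²` lattice points `x_{ij} = iμ₁ + jμ₂ ∈ Λ₀(f)` and their rational images
  have hx : ∀ p : Fin ℓ × Fin ℓ, ((p.1 : ℕ) : ℂ) * μ₁ + ((p.2 : ℕ) : ℂ) * μ₂ ∈ periodLattice D₁.f := fun p ↦ by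
    rw [← nsmul_eq_mul, ← nsmul_eq_mul]
    exact add_mem (AddSubgroup.nsmul_mem _ hμ₁ _) (AddSubgroup.nsmul_mem _ hμ₂ _)
  choose P hP using fun p : Fin ℓ × Fin ℓ ↦
    ShimuraCover.exists_rational_eq_uniformize_of_mem_periodLattice hF D₁ hD₁ (hx p)
  have hcx : ∀ p : Fin ℓ × Fin ℓ, (D₁.c : ℂ) * (((p.1 : ℕ) : ℂ) * μ₁ + ((p.2 : ℕ) : ℂ) * μ₂) =
      (((p.1 : ℕ) : ℤ) : ℂ) / ℓ * D₁.L.ω₁ + (((p.2 : ℕ) : ℤ) : ℂ) / ℓ * D₁.L.ω₂ := fun p ↦ by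
    rw [mul_add, ← mul_assoc, mul_comm (D₁.c : ℂ), mul_assoc, hω₁, ← mul_assoc, mul_comm (D₁.c : ℂ) ((p.2 : ℕ) : ℂ), mul_assoc, hω₂]
    push_cast; ring
  haveI : (W₁.baseChange ℚ).IsElliptic := by rw [baseChange]; infer_instance
  have hιinj : Function.Injective (Affine.Point.baseChange (W' := W₁) ℚ ℂ) := Affine.Point.map_injective _
  -- killed by `ℓ`
  have hℓP : ∀ p, ℓ • P p = 0 := fun p ↦ by
    apply hιinj
    rw [map_nsmul, map_zero, hP, ← map_nsmul, nsmul_eq_mul, hu0, hcx, mul_add, ← mul_assoc, ← mul_assoc,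
      mul_div_cancel₀ _ hℓC, mul_div_cancel₀ _ hℓC, ← zsmul_eq_mul, ← zsmul_eq_mul]
    exact add_mem (D₁.L.lattice.smul_mem _ D₁.L.ω₁_mem_lattice) (D₁.L.lattice.smul_mem _ D₁.L.ω₂_mem_lattice)
  -- pairwise distinct
  have hPinj : Function.Injective P := by
    intro p q hpq
    have h := congrArg (Affine.Point.baseChange (W' := W₁) ℚ ℂ) hpq
    rw [hP, hP, ← sub_eq_zero, ← map_sub, hu0, ← mul_sub, show
      ((p.1 : ℕ) : ℂ) * μ₁ + ((p.2 : ℕ) : ℂ) * μ₂ - (((q.1 : ℕ) : ℂ) * μ₁ + ((q.2 : ℕ) : ℂ) * μ₂) =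
        (((p.1 : ℕ) : ℂ) - ((q.1 : ℕ) : ℂ)) * μ₁ + (((p.2 : ℕ) : ℂ) - ((q.2 : ℕ) : ℂ)) * μ₂ by ring,
      mul_add, ← mul_assoc, mul_comm (D₁.c : ℂ), mul_assoc, hω₁, ← mul_assoc, mul_comm (D₁.c : ℂ) (_ - _), mul_assoc, hω₂,
      show (((p.1 : ℕ) : ℂ) - ((q.1 : ℕ) : ℂ)) * (D₁.L.ω₁ / ℓ) + (((p.2 : ℕ) : ℂ) - ((q.2 : ℕ) : ℂ)) * (D₁.L.ω₂ / ℓ) =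
        ((((p.1 : ℕ) : ℤ) - ((q.1 : ℕ) : ℤ) : ℤ) : ℂ) / ℓ * D₁.L.ω₁ + ((((p.2 : ℕ) : ℤ) - ((q.2 : ℕ) : ℤ) : ℤ) : ℂ) / ℓ * D₁.L.ω₂ by
        push_cast; ring,
      div_mul_ω₁_add_div_mul_ω₂_mem_lattice_iff D₁.L hℓ0] at h
    obtain ⟨h1, h2⟩ := h
    have hp1 := p.1.isLt; have hq1 := q.1.isLt; have hp2 := p.2.isLt; have hq2 := q.2.isLt
    have e1 : (p.1 : ℕ) = q.1 := by
      rcases h1 with ⟨k, hk⟩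
      have : (k : ℤ) = 0 := by
        rcases lt_trichotomy k 0 with hk0 | hk0 | hk0
        · nlinarith
        · exact hk0
        · nlinarith
      subst this; omega
    have e2 : (p.2 : ℕ) = q.2 := by
      rcases h2 with ⟨k, hk⟩
      have : (k : ℤ) = 0 := by
        rcases lt_trichotomy k 0 with hk0 | hk0 | hk0
        · nlinarith
        · exact hk0
        · nlinarith
      subst this; omega
    exact Prod.ext (Fin.ext e1) (Fin.ext e2)
  -- Mazur
  have hcard : ℓ < Fintype.card (Fin ℓ × Fin ℓ) := by
    rw [Fintype.card_prod, Fintype.card_fin]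
    nlinarith [hℓ.two_le]
  exact false_of_injective_of_mazurShape (hMT (W₁.baseChange ℚ)) hℓ hℓ2 hcard P hPinj hℓP

/-! ## §3 The lattice-optimal `X₀(N)`-datum form (es's E-es-189 binders), modulo CES in addition -/

/-- **E-es-189 `OptimalGamma1PeriodsNotInsideOddPrime`, body, CONDITIONAL on F★ ∧ mazur_torsion ∧ CES.**  For a lattice-optimal
`X₀(N)`-datum `D₀` of a globally minimal `W₀` and an odd prime `ℓ`: `Λ₁(f) ⊄ ℓΛ₀(f)` (`f = D₀.f`).  CES supplies Stevens' curve `W₁` with an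
optimal `X₁(N)`-datum of the same newform (`Gamma1ParametrizationData.f_eq_of_isIsogenous`); then §2.
[cite: Vatsal2005, Rem. 1.8] [cite: Mazur1977, Thm 8] [cite: ConradEdixhovenStein2003, Thm. 1.1.3, §6.2] -/
theorem not_prime_le_of_latticeOptimal (hF : optimalGamma1Parametrization_cusp_rational)
    (hMT : ∀ V : WeierstrassCurve ℚ, mazur_torsion V) (hCES : exists_optimal_gamma1ParametrizationData)
    (W₀ : WeierstrassCurve ℚ) [W₀.IsElliptic] [W₀.IsGloballyMinimal] (D₀ : ModularParametrizationData W₀ N)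
    (hopt : ∀ z ∈ D₀.L.lattice, ∃ w ∈ periodLattice D₀.f, z = D₀.c * w) {ℓ : ℕ} (hℓ : ℓ.Prime) (hℓ2 : ℓ ≠ 2) :
    ¬ (∀ z ∈ periodLatticeGamma1 D₀.f, ∃ w ∈ periodLattice D₀.f, z = (ℓ : ℂ) * w) := by
  obtain ⟨W₁, hW₁, _, D₁, hiso, hD₁⟩ := hCES W₀ D₀ hopt
  haveI := hW₁
  have hf : D₁.f = D₀.f := Gamma1ParametrizationData.f_eq_of_isIsogenous D₁ D₀ hiso
  rw [← hf]
  exact not_prime_le_of_isOptimal hF hMT D₁ hD₁ hℓ hℓ2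

end Summit.BirchSwinnertonDyer.BirchSwinnertonDyer.Theorems.ManinLocalTwoThree.ShimuraKernelOddPart

end
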